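import Literature.Barriers.ValiantsHypothesis.BDGIL24IsotypicProjectionProofs
import HarnessLib

/-!
# van den Berg–Dutta–Gesmundo–Ikenmeyer–Lysikov 2024, §2.2: homogeneous components of a
# metapolynomial — "a simple interpolation argument", PROVED

Theorem-only companion of the BDGIL24 cluster (val-lit row vdBDGIL24-A). The paper's first
reduction in §2.2 (p.7, PDF p.8), preceding the isotypic one (`BDGIL24IsotypicLowerBounds.lean`):
"Let `Δ` be a metapolynomial vanishing on `X_r` such that `Δ(f_hard) ≠ 0`. Write `Δ = Σ_i Δ^{(i)}`
for homogeneous metapolynomials `Δ^{(i)}` of degree `i`. If `X_r` is invariant under rescaling,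
one has `Δ^{(i)}(X_r) = 0` for every `i`. On the other hand, there exists at least one `i` such that
`Δ^{(i)}(f_hard) ≠ 0`. The relevant homogeneous component `Δ^{(i)}` can be extracted from `Δ` with
a simple interpolation argument, and one has `cc(Δ^{(i)}) ≤ (deg(Δ) + 1) · cc(Δ)`."

* `aeval_C_mul_X_eq_sum_homogeneousComponent` — `Δ(λ x) = Σ_n λ^n Δ^{(n)}(x)`;
* `homogeneousComponent_eq_sum_interpolation` — with `deg Δ + 1` distinct nodes `λ_j` and the
  inverse Vandermonde matrix, `Δ^{(i)} = Σ_j (V⁻¹)_{ij} Δ(λ_j x)` ("a simple interpolation argument");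
* `affComplexity_homogeneousComponent_le` — **`cc(Δ^{(i)}) ≤ (deg Δ + 1)(cc Δ + 2)`** for every
  polynomial `Δ` over `ℂ` in finitely many variables. CONSTANT: the print's `(deg Δ + 1) · cc(Δ)`
  does not book the interpolation's own arithmetic; in the tree's gate count `affComplexity` (affine
  inputs free, every `+`/`×` gate counted, `affComplexity_sum_smul_le`) each of the `deg Δ + 1`
  rescaled copies `Δ(λ_j x)` costs `cc(Δ)` (`affComplexity_aeval_le_of_forall_le_one`) plus one scalar
  multiplication and one addition — whence `+2`. Disclosed, not a weakening of the method.
* `eval_homogeneousComponent_eq_zero_of_forall_smul` — if `Δ` vanishes at `μ_j • y` for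
  `deg Δ + 1` distinct scalars `μ_j`, every `Δ^{(i)}` vanishes at `y` (Vandermonde);
* `homogeneousComponent_vanishes_on_slice` — for an INVARIANT measure `c` and `d ≥ 1` the slices
  `X_{d,r}` are invariant under rescaling (`pow_smul_mem_slice`: the scalar matrix `λ·1 ∈ GL_k` acts on
  degree-`d` forms by `λ^d`, and every rescaling needed is of this form), so each `Δ^{(i)}` vanishes
  on `X_{d,r}` when `Δ` does;
* `exists_homogeneousComponent_lowerBound` — the quoted sentence: some `Δ^{(i)}`, `i ≤ deg Δ`,
  vanishes on `X_{d,r}`, has `Δ^{(i)}(f) ≠ 0` and `cc(Δ^{(i)}) ≤ (deg Δ + 1)(cc Δ + 2)`.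
Scope: `d ≥ 1` (for `d = 0` "forms" are constants, rescaling is trivial and the sentence fails,
e.g. `Δ = c − 1` at the constant form `1`). No definitions, no named facts (net debt 0). Honest
framing: transfer statements about lower-bound witnesses; nothing here bears on `VP ≠ VNP`.

## References
* [BergEtAl2024] arXiv:2411.03444, §2.2 p.7 (PDF p.8, held text `paper:arxiv-2411.03444`
  p0008.txt:L28–L38).

## Mathlib and tree
Mathlib: `MvPolynomial.homogeneousComponent`, `sum_homogeneousComponent`, `Matrix.vandermonde`,
`Matrix.eq_zero_of_mulVec_eq_zero`. Tree: `BDGIL24WeightProjectionProofs`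
(`affComplexity_aeval_le_of_forall_le_one`, `affComplexity_sum_smul_le`,
`affComplexity_eq_zero_of_totalDegree_le_one`, `vandermonde_inv_mul_pow`),
`OrbitClosureProofs.eval_smul_of_isHomogeneous`, `OrbitCoordinateRing.formCoeff_smul`,
`LinSubst.linSubst`, `BDGIL24IsotypicNaturalProofs` (`slice`, `IsInvariantMeasure`, `affComplexity`).
-/

noncomputable section

open MvPolynomial
open Literature.Computability.AlgebraicComplexity Literature.NumberTheory.DiophantineGeometry

namespace Literature.Barriers.ValiantsHypothesis

namespace BergEtAl2024

/-! ### Rescaling the variables and homogeneous components -/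

section Rescale

variable {τ : Type*} {R : Type*} [CommSemiring R]

/-- Forms scale: `φ(λ x) = λ^n φ(x)` as polynomials, for `φ` homogeneous of degree `n`.
[cite: BergEtAl2024, §2.2, p.7 (PDF p.8)] locator: paper:arxiv-2411.03444 p0008.txt:L30 -/
theorem aeval_C_mul_X_of_isHomogeneous {φ : MvPolynomial τ R} {n : ℕ} (hφ : φ.IsHomogeneous n)
    (a : R) : aeval (fun v => C a * X v) φ = a ^ n • φ := by
  classical
  conv_lhs => rw [φ.as_sum, map_sum]
  conv_rhs => rw [φ.as_sum, Finset.smul_sum]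
  refine Finset.sum_congr rfl fun m hm => ?_
  have hdeg : n = ∑ i ∈ m.support, m i := hφ.degree_eq_sum_deg_support hm
  rw [aeval_monomial, monomial_eq, smul_eq_C_mul, algebraMap_eq]
  simp only [Finsupp.prod, mul_pow, Finset.prod_mul_distrib]
  rw [Finset.prod_pow_eq_pow_sum, ← hdeg, ← map_pow]
  ring

/-- **`Δ(λ x) = Σ_{n ≤ deg Δ} λ^n Δ^{(n)}(x)`** (as polynomials).
[cite: BergEtAl2024, §2.2, p.7 (PDF p.8)] locator: paper:arxiv-2411.03444 p0008.txt:L30 -/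
theorem aeval_C_mul_X_eq_sum_homogeneousComponent (Δ : MvPolynomial τ R) (a : R) :
    aeval (fun v => C a * X v) Δ =
      ∑ n ∈ Finset.range (Δ.totalDegree + 1), a ^ n • homogeneousComponent n Δ := by
  conv_lhs => rw [← sum_homogeneousComponent Δ, map_sum]
  exact Finset.sum_congr rfl fun n _ =>
    aeval_C_mul_X_of_isHomogeneous (homogeneousComponent_isHomogeneous n Δ) a

/-- `Δ(μ • y) = Σ_{n ≤ deg Δ} μ^n Δ^{(n)}(y)` (values).
[cite: BergEtAl2024, §2.2, p.7 (PDF p.8)] locator: paper:arxiv-2411.03444 p0008.txt:L30 -/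
theorem eval_smul_eq_sum_homogeneousComponent {K : Type*} [Field K] (Δ : MvPolynomial τ K)
    (μ : K) (y : τ → K) :
    eval (μ • y) Δ =
      ∑ n ∈ Finset.range (Δ.totalDegree + 1), μ ^ n * eval y (homogeneousComponent n Δ) := by
  conv_lhs => rw [← sum_homogeneousComponent Δ, map_sum]
  exact Finset.sum_congr rfl fun n _ =>
    eval_smul_of_isHomogeneous (homogeneousComponent_isHomogeneous n Δ) μ y

end Rescale

/-! ### Interpolation: extracting `Δ^{(i)}` -/

section Interpolation

variable {τ : Type*}

/-- Distinct interpolation nodes `1, 2, …, D+1` in `ℂ`. [cite: BergEtAl2024, §2.2, p.7 (PDF p.8)] locator: paper:arxiv-2411.03444 p0008.txt:L33 -/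
theorem nodes_injective (D : ℕ) : Function.Injective (fun j : Fin (D + 1) => ((j : ℕ) : ℂ) + 1) := by
  intro a b h
  have h' : ((a : ℕ) : ℂ) = ((b : ℕ) : ℂ) := add_right_cancel h
  exact Fin.ext (Nat.cast_injective h')

/-- **"A simple interpolation argument"**: with distinct nodes `λ₀, …, λ_D` (`D = deg Δ`) and
`V = (λ_j^n)` the Vandermonde matrix, `Δ^{(i)} = Σ_j (V⁻¹)_{ij} · Δ(λ_j x)`.
[cite: BergEtAl2024, §2.2, p.7 (PDF p.8)] locator: paper:arxiv-2411.03444 p0008.txt:L33 -/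
theorem homogeneousComponent_eq_sum_interpolation (Δ : MvPolynomial τ ℂ)
    (x : Fin (Δ.totalDegree + 1) → ℂ) (hx : Function.Injective x) (i : Fin (Δ.totalDegree + 1)) :
    homogeneousComponent i Δ =
      ∑ j, (Matrix.vandermonde x)⁻¹ i j • aeval (fun v => C (x j) * X v) Δ := by
  simp_rw [aeval_C_mul_X_eq_sum_homogeneousComponent, Finset.sum_range, Finset.smul_sum, smul_smul]
  rw [Finset.sum_comm]
  simp_rw [← Finset.sum_smul]
  simp_rw [vandermonde_inv_mul_pow x hx i]
  rw [Finset.sum_eq_single i]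
  · rw [if_pos rfl, one_smul]
  · intro n _ hn
    rw [if_neg (Ne.symm hn), zero_smul]
  · intro h
    exact absurd (Finset.mem_univ i) h

/-- **Vandermonde**: if `Δ(μ_j • y) = 0` for `deg Δ + 1` distinct scalars `μ_j`, then every
homogeneous component of `Δ` vanishes at `y`.
[cite: BergEtAl2024, §2.2, p.7 (PDF p.8)] locator: paper:arxiv-2411.03444 p0008.txt:L31–L32 -/
theorem eval_homogeneousComponent_eq_zero_of_forall_smul (Δ : MvPolynomial τ ℂ) (y : τ → ℂ)
    (μ : Fin (Δ.totalDegree + 1) → ℂ) (hμ : Function.Injective μ)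
    (h : ∀ j, eval (μ j • y) Δ = 0) (n : ℕ) : eval y (homogeneousComponent n Δ) = 0 := by
  by_cases hn : Δ.totalDegree < n
  · rw [homogeneousComponent_eq_zero n Δ hn, map_zero]
  · have hn' : n < Δ.totalDegree + 1 := by omega
    set e : Fin (Δ.totalDegree + 1) → ℂ := fun m => eval y (homogeneousComponent m Δ) with he
    have hsys : (Matrix.vandermonde μ).mulVec e = 0 := by
      funext j
      rw [Matrix.mulVec, dotProduct, Pi.zero_apply, ← h j, eval_smul_eq_sum_homogeneousComponent,
        Finset.sum_range]
      exact Finset.sum_congr rfl fun m _ => by rw [Matrix.vandermonde_apply]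
    have hdet : (Matrix.vandermonde μ).det ≠ 0 := Matrix.det_vandermonde_ne_zero_iff.2 hμ
    have he0 := Matrix.eq_zero_of_mulVec_eq_zero hdet hsys
    exact congr_fun he0 ⟨n, hn'⟩

variable [Fintype τ]

/-- **`cc(Δ^{(i)}) ≤ (deg Δ + 1)·(cc Δ + 2)`** — the homogeneous components of a polynomial with a
small circuit have small circuits (interpolation over `deg Δ + 1` rescalings; affine inputs free).
The print states `(deg Δ + 1) · cc(Δ)`, not booking the `deg Δ` additions and `deg Δ + 1` scalar
multiplications of the interpolation; the tree's `affComplexity` counts every gate.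
[cite: BergEtAl2024, §2.2, p.7 (PDF p.8)] locator: paper:arxiv-2411.03444 p0008.txt:L33–L34 -/
theorem affComplexity_homogeneousComponent_le (Δ : MvPolynomial τ ℂ) (i : ℕ) :
    affComplexity (homogeneousComponent i Δ) ≤ (Δ.totalDegree + 1) * (affComplexity Δ + 2) := by
  by_cases hi : Δ.totalDegree < i
  · rw [homogeneousComponent_eq_zero i Δ hi,
      affComplexity_eq_zero_of_totalDegree_le_one (by rw [totalDegree_zero]; exact Nat.zero_le _)]
    exact Nat.zero_le _
  · set x : Fin (Δ.totalDegree + 1) → ℂ := fun j => ((j : ℕ) : ℂ) + 1 with hxdef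
    have hx : Function.Injective x := nodes_injective _
    have hi' : i < Δ.totalDegree + 1 := by omega
    rw [show i = ((⟨i, hi'⟩ : Fin (Δ.totalDegree + 1)) : ℕ) from rfl,
      homogeneousComponent_eq_sum_interpolation Δ x hx ⟨i, hi'⟩]
    refine (affComplexity_sum_smul_le _ _ _).trans ?_
    have hle : ∀ j : Fin (Δ.totalDegree + 1),
        affComplexity (aeval (fun v => C (x j) * X v) Δ) + 2 ≤ affComplexity Δ + 2 := fun j =>
      Nat.add_le_add_right (affComplexity_aeval_le_of_forall_le_one Δ
        (fun v => (isHomogeneous_C_mul_X (x j) v).totalDegree_le)) 2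
    refine (Finset.sum_le_sum fun j _ => hle j).trans ?_
    rw [Finset.sum_const, Finset.card_univ, Fintype.card_fin, smul_eq_mul]

end Interpolation

/-! ### Slices of an invariant measure are invariant under rescaling; the §2.2 reduction -/

section Slice

variable {k d : ℕ}

/-- The scalar matrix `a · 1 ∈ GL_k` acts on a form of degree `d` by `a^d`.
[cite: BergEtAl2024, §2.2, p.7 (PDF p.8)] locator: paper:arxiv-2411.03444 p0008.txt:L31 -/
theorem linSubst_smul_one_of_isHomogeneous {f : MvPolynomial (Fin k) ℂ} (hf : f.IsHomogeneous d)
    (a : ℂ) : linSubst (Fin k) ℂ (a • (1 : Matrix (Fin k) (Fin k) ℂ)) f = a ^ d • f := by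
  have hfun : (fun i : Fin k => ∑ j, (a • (1 : Matrix (Fin k) (Fin k) ℂ)) j i •
      (X j : MvPolynomial (Fin k) ℂ)) = fun v => C a * X v := by
    funext i
    rw [Finset.sum_eq_single i]
    · rw [Matrix.smul_apply, Matrix.one_apply_eq, smul_eq_mul, mul_one, smul_eq_C_mul]
    · intro j _ hj
      rw [Matrix.smul_apply, Matrix.one_apply_ne hj, smul_zero, zero_smul]
    · intro h
      exact absurd (Finset.mem_univ i) h
  rw [linSubst, hfun]
  exact aeval_C_mul_X_of_isHomogeneous hf a

/-- **`X_{d,r}` is invariant under rescaling** (`d ≥ 1`, `a ≠ 0`): for an invariant measure the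
scalar matrix `λ·1` (`λ^d = a`) lies in `GL_k` and multiplies degree-`d` forms by `a`.
[cite: BergEtAl2024, §2.2, p.7 (PDF p.8)] locator: paper:arxiv-2411.03444 p0008.txt:L31 -/
theorem pow_smul_mem_slice {c : (k d : ℕ) → MvPolynomial (Fin k) ℂ → ℕ} (hc : IsInvariantMeasure c)
    {r : ℕ} {g : MvPolynomial (Fin k) ℂ} (hg : g ∈ slice c k d r) {a : ℂ} (ha : a ≠ 0) :
    a ^ d • g ∈ slice c k d r := by
  obtain ⟨hgd, hgr⟩ := hg
  refine ⟨?_, ?_⟩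
  · intro m hm
    rw [coeff_smul, smul_eq_mul] at hm
    exact hgd (right_ne_zero_of_mul hm)
  · have hdet : (a • (1 : Matrix (Fin k) (Fin k) ℂ)).det ≠ 0 := by
      rw [Matrix.det_smul, Matrix.det_one, mul_one]
      exact pow_ne_zero _ ha
    have h := hc k d (Matrix.GeneralLinearGroup.mkOfDetNeZero _ hdet) g hgd
    rw [linSubstRep_apply] at h
    change c k d (linSubst (Fin k) ℂ (a • (1 : Matrix (Fin k) (Fin k) ℂ)) g) = c k d g at h
    rw [linSubst_smul_one_of_isHomogeneous hgd] at h
    rw [h]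
    exact hgr

/-- **"If `X_r` is invariant under rescaling, one has `Δ^{(i)}(X_r) = 0` for every `i`"** — for an
invariant measure and `d ≥ 1`: a metapolynomial vanishing on `X_{d,r}` has all its homogeneous
components vanishing on `X_{d,r}` (rescale by `(j+1)^d`, `j = 0, …, deg Δ`, and invert the
Vandermonde system). [cite: BergEtAl2024, §2.2, p.7 (PDF p.8)] locator: paper:arxiv-2411.03444 p0008.txt:L31–L32 -/
theorem homogeneousComponent_vanishes_on_slice {c : (k d : ℕ) → MvPolynomial (Fin k) ℂ → ℕ}
    (hc : IsInvariantMeasure c) (hd : 0 < d) {r : ℕ} {Δ : MvPolynomial (DegIdx (Fin k) d) ℂ}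
    (hvan : ∀ g ∈ slice c k d r, eval (formCoeff d g) Δ = 0) (n : ℕ) :
    ∀ g ∈ slice c k d r, eval (formCoeff d g) (homogeneousComponent n Δ) = 0 := by
  intro g hg
  set μ : Fin (Δ.totalDegree + 1) → ℂ := fun j => (((j : ℕ) : ℂ) + 1) ^ d with hμdef
  have hμ : Function.Injective μ := by
    intro a b h
    have h1 : (((a : ℕ) + 1) ^ d : ℕ) = (((b : ℕ) + 1) ^ d : ℕ) := by
      have h' : ((((a : ℕ) + 1) ^ d : ℕ) : ℂ) = ((((b : ℕ) + 1) ^ d : ℕ) : ℂ) := by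
        push_cast
        exact h
      exact Nat.cast_injective h'
    exact Fin.ext (by simpa using Nat.pow_left_injective hd.ne' h1)
  refine eval_homogeneousComponent_eq_zero_of_forall_smul Δ (formCoeff d g) μ hμ (fun j => ?_) n
  have hne : (((j : ℕ) : ℂ) + 1) ≠ 0 := by
    rw [← Nat.cast_succ]
    exact Nat.cast_ne_zero.2 (Nat.succ_ne_zero _)
  have hmem := pow_smul_mem_slice hc hg hne
  rw [← formCoeff_smul]
  exact hvan _ hmem

/-- **"There exists at least one `i` such that `Δ^{(i)}(f_hard) ≠ 0`."**
[cite: BergEtAl2024, §2.2, p.7 (PDF p.8)] locator: paper:arxiv-2411.03444 p0008.txt:L32 -/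
theorem exists_eval_homogeneousComponent_ne_zero {τ : Type*} (Δ : MvPolynomial τ ℂ) {y : τ → ℂ}
    (hy : eval y Δ ≠ 0) : ∃ i ≤ Δ.totalDegree, eval y (homogeneousComponent i Δ) ≠ 0 := by
  rw [← sum_homogeneousComponent Δ, map_sum] at hy
  obtain ⟨i, hi, hne⟩ := Finset.exists_ne_zero_of_sum_ne_zero hy
  exact ⟨i, Nat.lt_succ_iff.1 (Finset.mem_range.1 hi), hne⟩

/-- **§2.2, the homogeneous reduction** (p.7): "if the lower bound `c(f_hard) > r` can be proved via
a metapolynomial `Δ` satisfying `cc(Δ) ≤ s`, then the same lower bound can be proved via a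
homogeneous metapolynomial `Δ^{(i)}` satisfying `cc(Δ^{(i)}) ≤ (deg(Δ) + 1) s`" — here for an
invariant measure `c` (so that `X_{d,r}` is invariant under rescaling), `d ≥ 1`, with the tree's
constant `(deg Δ + 1)(s + 2)` (interpolation gates booked, see
`affComplexity_homogeneousComponent_le`). [cite: BergEtAl2024, §2.2, p.7 (PDF p.8)] locator: paper:arxiv-2411.03444 p0008.txt:L34–L36 -/
theorem exists_homogeneousComponent_lowerBound {c : (k d : ℕ) → MvPolynomial (Fin k) ℂ → ℕ}
    (hc : IsInvariantMeasure c) (hd : 0 < d) {r s : ℕ} {Δ : MvPolynomial (DegIdx (Fin k) d) ℂ}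
    (hs : affComplexity Δ ≤ s) (hvan : ∀ g ∈ slice c k d r, eval (formCoeff d g) Δ = 0)
    {f : MvPolynomial (Fin k) ℂ} (hf : eval (formCoeff d f) Δ ≠ 0) :
    ∃ i ≤ Δ.totalDegree, (homogeneousComponent i Δ).IsHomogeneous i ∧
      (∀ g ∈ slice c k d r, eval (formCoeff d g) (homogeneousComponent i Δ) = 0) ∧
      eval (formCoeff d f) (homogeneousComponent i Δ) ≠ 0 ∧
      affComplexity (homogeneousComponent i Δ) ≤ (Δ.totalDegree + 1) * (s + 2) := by
  obtain ⟨i, hi, hne⟩ := exists_eval_homogeneousComponent_ne_zero Δ hf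
  exact ⟨i, hi, homogeneousComponent_isHomogeneous i Δ,
    homogeneousComponent_vanishes_on_slice hc hd hvan i, hne,
    (affComplexity_homogeneousComponent_le Δ i).trans
      (Nat.mul_le_mul_left _ (Nat.add_le_add_right hs 2))⟩

end Slice

end BergEtAl2024

end Literature.Barriers.ValiantsHypothesis
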